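import Literature.NumberTheory.LFunctions.SymmetricHadamardDerivatives
import HarnessLib

/-!
# The zeros of a symmetric entire function as a weighted node family

Topic `Literature/NumberTheory/LFunctions`, namespace `Literature.NumberTheory.LFunctions.Stark1974`
(continuation of `SymmetricHadamardDerivatives.lean`).  Everything here is PROVED; `nodeVal`, `nodeWt`
are definitions with bodies.

For `D : SymmHadamardData F` the zeros of `F` other than `1/2` are `ρ_{n,+} = 1/2 + ζₙ`,
`ρ_{n,−} = 1/2 − ζₙ` (`nodeVal D (n, b)`), all with `0 ≤ Re ρ ≤ 1`; we give them weight `nodeWt = 1`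
(`0` for the padding indices with `cₙ = 0`).  For a point `s` with `Re s > 1`:

* `norm_inv_sq_le_mul_re_inv` — `|s − ρ|^{−2} ≤ (Re s − 1)^{−1} Re (s − ρ)^{−1}` for `Re ρ ≤ 1`;
* `summable_nodeWt_mul_norm_inv_sq`, `tsum_nodeWt_mul_norm_inv_sq_le` — `Σ_{n,±} w |s − ρ|^{−2}` converges
  and is `≤ (Re s − 1)^{−1} · Re Σₙ Zₙ(0, s)` (`Zₙ = D.zeroTerm`);
* `hasSum_nodeWt_mul_inv_pow` — for `k ≥ 1`, `Σ_{(n,±)} w ((s − ρ_{n,±})^{k+1})⁻¹ = Σₙ Zₙ(k, s)`, the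
  family being absolutely summable (`summable_norm_nodeWt_mul_inv_pow`).

This is the bookkeeping that turns the explicit formula `(F'/F)^{(k)} = (−1)^k k!(2m(s−½)^{−k−1} + ΣZₙ)`
into a sum over individual zeros, as consumed by the Deuring–Heilbronn power-sum argument
[cite: ThornerZaman2017, §7.2] [cite: LagariasMontgomeryOdlyzko1979, §4].

## References

* J. Thorner, A. Zaman, Algebra Number Theory 11 (2017), §7. [ThornerZaman2017]
* J. C. Lagarias, H. L. Montgomery, A. M. Odlyzko, Invent. Math. 54 (1979), §3–4. [LagariasMontgomeryOdlyzko1979]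
-/

noncomputable section

open Complex Metric Set Filter Topology

namespace Literature.NumberTheory.LFunctions.Stark1974

/-- **`|s − ρ|^{−2} ≤ (Re s − 1)^{−1} · Re (s − ρ)^{−1}`** for `Re ρ ≤ 1 < Re s`. [folklore] -/
theorem norm_inv_sq_le_mul_re_inv {s ρ : ℂ} (hρ : ρ.re ≤ 1) (hs : 1 < s.re) :
    ‖((s - ρ) ^ 2)⁻¹‖ ≤ (s.re - 1)⁻¹ * ((s - ρ)⁻¹).re := by
  have hne : s - ρ ≠ 0 := fun h ↦ by
    have := congrArg Complex.re h; simp at this; linarith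
  have hpos : 0 < ‖s - ρ‖ ^ 2 := by positivity
  rw [norm_inv, norm_pow, Complex.inv_re, Complex.normSq_eq_norm_sq, sub_re]
  rw [inv_eq_one_div, div_le_iff₀ hpos]
  have h1 : 0 < s.re - 1 := by linarith
  have : (s.re - 1)⁻¹ * ((s.re - ρ.re) / ‖s - ρ‖ ^ 2) * ‖s - ρ‖ ^ 2 = (s.re - ρ.re) / (s.re - 1) := by
    field_simp
  rw [this, le_div_iff₀ h1]
  linarith

/-- `Re (s − ρ)^{−1} ≥ 0` for `Re ρ ≤ 1 < Re s`. [folklore] -/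
theorem re_inv_sub_nonneg {s ρ : ℂ} (hρ : ρ.re ≤ 1) (hs : 1 < s.re) : 0 ≤ ((s - ρ)⁻¹).re := by
  rw [Complex.inv_re, sub_re]
  exact div_nonneg (by linarith) (Complex.normSq_nonneg _)

/-- `|s − ρ| ≥ Re s − 1` for `Re ρ ≤ 1`. [folklore] -/
theorem re_sub_one_le_norm_sub {s ρ : ℂ} (hρ : ρ.re ≤ 1) : s.re - 1 ≤ ‖s - ρ‖ := by
  have := abs_re_le_norm (s - ρ)
  rw [sub_re] at this
  linarith [le_abs_self (s.re - ρ.re)]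

namespace SymmHadamardData

variable {F : ℂ → ℂ} (D : SymmHadamardData F)

/-- The zeros carried by the `n`-th factor: `ρ_{n,true} = 1/2 + ζₙ`, `ρ_{n,false} = 1/2 − ζₙ`.
[cite: Stark1974, Lemma 3 (proof)] -/
def nodeVal (p : ℕ × Bool) : ℂ := if p.2 then 1 / 2 + D.node p.1 else 1 / 2 - D.node p.1

/-- Their weights: `1`, or `0` for the padding indices `cₙ = 0`. [folklore] -/
def nodeWt (p : ℕ × Bool) : ℝ := if D.c p.1 = 0 then 0 else 1

/-- `ρ_{n,true} = 1/2 + ζₙ`. [folklore] -/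
@[simp] theorem nodeVal_true (n : ℕ) : D.nodeVal (n, true) = 1 / 2 + D.node n := by simp [nodeVal]

/-- `ρ_{n,false} = 1/2 − ζₙ`. [folklore] -/
@[simp] theorem nodeVal_false (n : ℕ) : D.nodeVal (n, false) = 1 / 2 - D.node n := by simp [nodeVal]

/-- Unfolding the weight. [folklore] -/
theorem nodeWt_apply (n : ℕ) (b : Bool) : D.nodeWt (n, b) = if D.c n = 0 then 0 else 1 := rfl

/-- `nodeWt ≥ 0`. [folklore] -/
theorem nodeWt_nonneg (p : ℕ × Bool) : 0 ≤ D.nodeWt p := by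
  unfold nodeWt; split_ifs <;> norm_num

/-- `nodeWt ≤ 1`. [folklore] -/
theorem nodeWt_le_one (p : ℕ × Bool) : D.nodeWt p ≤ 1 := by
  unfold nodeWt; split_ifs <;> norm_num

/-- A positive weight is `1`. [folklore] -/
theorem nodeWt_eq_one_of_pos {p : ℕ × Bool} (h : 0 < D.nodeWt p) : D.nodeWt p = 1 := by
  unfold nodeWt at h ⊢; split_ifs with hc
  · simp [hc] at h
  · rfl

/-- `nodeWt (n, b) = 1` iff `cₙ ≠ 0`. [folklore] -/
theorem nodeWt_eq_one_iff {p : ℕ × Bool} : D.nodeWt p = 1 ↔ D.c p.1 ≠ 0 := by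
  unfold nodeWt; split_ifs with hc <;> simp [hc]

/-- The nodes lie in the closed critical strip: `0 ≤ Re ρ ≤ 1` (when `cₙ ≠ 0`). [cite: Stark1974, Lemma 3] -/
theorem nodeVal_re_mem {p : ℕ × Bool} (hp : D.c p.1 ≠ 0) :
    0 ≤ (D.nodeVal p).re ∧ (D.nodeVal p).re ≤ 1 := by
  have h := D.re_half_add_node_mem hp
  unfold nodeVal; split_ifs
  · exact ⟨h.1, h.2.1⟩
  · exact ⟨h.2.2.1, h.2.2.2⟩

/-- `Re ρ ≤ 1` for every node of positive weight. [folklore] -/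
theorem nodeVal_re_le_one {p : ℕ × Bool} (hp : 0 < D.nodeWt p) : (D.nodeVal p).re ≤ 1 :=
  (D.nodeVal_re_mem (D.nodeWt_eq_one_iff.mp (D.nodeWt_eq_one_of_pos hp))).2

/-- A zero `ρ ≠ 1/2` of `F` is a node of weight `1`. [cite: Conway1978, Ch. XI Thm. 3.4] -/
theorem exists_nodeVal_eq_of_zero {ρ : ℂ} (hρ : F ρ = 0) (hρ' : ρ ≠ 1 / 2) :
    ∃ p : ℕ × Bool, D.nodeWt p = 1 ∧ D.nodeVal p = ρ := by
  obtain ⟨n, hn, h⟩ := D.exists_index_of_zero hρ hρ'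
  rcases D.eq_half_add_or_sub_node hn h with h1 | h1
  · exact ⟨(n, true), D.nodeWt_eq_one_iff.mpr hn, by simp [nodeVal, h1]⟩
  · exact ⟨(n, false), D.nodeWt_eq_one_iff.mpr hn, by simp [nodeVal, h1]⟩

/-- If `cₙ(ρ − 1/2)² = −1` then `ρ` is one of the two nodes of index `n` and `1 − ρ` is the other.
[folklore] -/
theorem nodeVal_pair_of_root {ρ : ℂ} {n : ℕ} (h : D.c n * (ρ - 1 / 2) ^ 2 = -1) :
    ∃ b : Bool, D.nodeVal (n, b) = ρ ∧ D.nodeVal (n, !b) = 1 - ρ := by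
  have hn : D.c n ≠ 0 := by rintro h0; rw [h0, zero_mul] at h; norm_num at h
  rcases D.eq_half_add_or_sub_node hn h with h1 | h1
  · refine ⟨true, by simp [nodeVal, h1], ?_⟩
    simp [nodeVal]; rw [h1]; ring
  · refine ⟨false, by simp [nodeVal, h1], ?_⟩
    simp [nodeVal]; rw [h1]; ring

/-- The zero term split over the two nodes:
`Zₙ(k,s) = Σ_{b} w(n,b) ((s − ρ_{n,b})^{k+1})⁻¹`. [folklore] -/
theorem zeroTerm_eq_sum_bool (k : ℕ) (s : ℂ) (n : ℕ) :
    D.zeroTerm k s n = ∑ b : Bool, (D.nodeWt (n, b) : ℂ) * ((s - D.nodeVal (n, b)) ^ (k + 1))⁻¹ := by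
  rw [Fintype.sum_bool, nodeVal_true, nodeVal_false, nodeWt_apply, nodeWt_apply, zeroTerm]
  by_cases hc : D.c n = 0
  · simp [hc]
  · simp only [hc, if_false, ofReal_one, one_mul]
    ring_nf

/-! ### Summability over the nodes at a point with `Re s > 1` -/

variable {s : ℂ}

/-- The comparison family: `h(n,b) = w(n,b) · Re (s − ρ_{n,b})⁻¹ ≥ 0`, with fibre sums `Re Zₙ(0,s)`.
[folklore] -/
theorem hasSum_re_zeroTerm_zero (hF : Differentiable ℂ F) (hs : 1 < s.re) (hFs : F s ≠ 0) :
    Summable fun p : ℕ × Bool ↦ D.nodeWt p * ((s - D.nodeVal p)⁻¹).re := by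
  have hnn : 0 ≤ fun p : ℕ × Bool ↦ D.nodeWt p * ((s - D.nodeVal p)⁻¹).re := by
    intro p
    rcases (D.nodeWt_nonneg p).eq_or_lt with h | h
    · simp [← h]
    · exact mul_nonneg (D.nodeWt_nonneg p) (re_inv_sub_nonneg (D.nodeVal_re_le_one h) hs)
  refine (summable_prod_of_nonneg hnn).mpr ⟨fun n ↦ ?_, ?_⟩
  · exact (hasSum_fintype _).summable
  · have h0 := (D.hasSum_zeroTerm hF hFs 0).summable
    have h1 : Summable fun n ↦ (D.zeroTerm 0 s n).re := (Complex.hasSum_re h0.hasSum).summable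
    refine h1.congr fun n ↦ ?_
    rw [tsum_fintype, D.zeroTerm_eq_sum_bool, Complex.re_sum]
    refine Finset.sum_congr rfl fun b _ ↦ ?_
    rw [zero_add, pow_one, Complex.re_ofReal_mul]

/-- **`Σ_{(n,±)} w |s − ρ|^{−2}` converges** at every `s` with `Re s > 1`, `F(s) ≠ 0`.
[cite: ThornerZaman2017, Lemma 7.4] -/
theorem summable_nodeWt_mul_norm_inv_sq (hF : Differentiable ℂ F) (hs : 1 < s.re) (hFs : F s ≠ 0) :
    Summable fun p : ℕ × Bool ↦ D.nodeWt p * ‖((s - D.nodeVal p) ^ 2)⁻¹‖ := by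
  refine Summable.of_nonneg_of_le (fun p ↦ mul_nonneg (D.nodeWt_nonneg p) (norm_nonneg _))
    (fun p ↦ ?_) ((D.hasSum_re_zeroTerm_zero hF hs hFs).mul_left (s.re - 1)⁻¹)
  rcases (D.nodeWt_nonneg p).eq_or_lt with h | h
  · simp [← h]
  · rw [← mul_assoc, mul_comm (s.re - 1)⁻¹, mul_assoc]
    exact mul_le_mul_of_nonneg_left (norm_inv_sq_le_mul_re_inv (D.nodeVal_re_le_one h) hs)
      (D.nodeWt_nonneg p)

/-- **The `M`-bound for the zeros**: `Σ_{(n,±)} w |s − ρ|^{−2} ≤ (Re s − 1)^{−1} Re Σₙ Zₙ(0,s)`.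
[cite: ThornerZaman2017, Lemma 7.4] -/
theorem tsum_nodeWt_mul_norm_inv_sq_le (hF : Differentiable ℂ F) (hs : 1 < s.re) (hFs : F s ≠ 0) :
    ∑' p : ℕ × Bool, D.nodeWt p * ‖((s - D.nodeVal p) ^ 2)⁻¹‖ ≤
      (s.re - 1)⁻¹ * (∑' n, D.zeroTerm 0 s n).re := by
  have hsum := D.hasSum_re_zeroTerm_zero hF hs hFs
  have hle := (D.summable_nodeWt_mul_norm_inv_sq hF hs hFs).tsum_le_tsum (fun p ↦ ?_) (hsum.mul_left (s.re - 1)⁻¹)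
  · refine hle.trans (le_of_eq ?_)
    rw [tsum_mul_left, hsum.tsum_prod, Complex.re_tsum (D.summable_zeroTerm hF hFs 0)]
    congr 1
    refine tsum_congr fun n ↦ ?_
    rw [tsum_fintype, D.zeroTerm_eq_sum_bool, Complex.re_sum]
    refine Finset.sum_congr rfl fun b _ ↦ ?_
    rw [zero_add, pow_one, Complex.re_ofReal_mul]
  · rcases (D.nodeWt_nonneg p).eq_or_lt with h | h
    · simp [← h]
    · rw [← mul_assoc, mul_comm (s.re - 1)⁻¹, mul_assoc]
      exact mul_le_mul_of_nonneg_left (norm_inv_sq_le_mul_re_inv (D.nodeVal_re_le_one h) hs)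
        (D.nodeWt_nonneg p)

/-- The node family with exponent `k + 1 ≥ 2` is absolutely summable. [folklore] -/
theorem summable_norm_nodeWt_mul_inv_pow (hF : Differentiable ℂ F) (hs : 1 < s.re) (hFs : F s ≠ 0)
    {k : ℕ} (hk : 1 ≤ k) :
    Summable fun p : ℕ × Bool ↦ ‖(D.nodeWt p : ℂ) * ((s - D.nodeVal p) ^ (k + 1))⁻¹‖ := by
  have hα : 0 < s.re - 1 := by linarith
  refine Summable.of_nonneg_of_le (fun p ↦ norm_nonneg _) (fun p ↦ ?_)
    ((D.summable_nodeWt_mul_norm_inv_sq hF hs hFs).mul_right (((s.re - 1)⁻¹) ^ (k - 1)))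
  rcases (D.nodeWt_nonneg p).eq_or_lt with h | h
  · simp [← h]
  · have hρ := D.nodeVal_re_le_one h
    have hd : s.re - 1 ≤ ‖s - D.nodeVal p‖ := re_sub_one_le_norm_sub hρ
    have hd0 : 0 < ‖s - D.nodeVal p‖ := lt_of_lt_of_le hα hd
    rw [norm_mul, Complex.norm_real, Real.norm_of_nonneg (D.nodeWt_nonneg p), norm_inv, norm_pow,
      norm_inv, norm_pow, mul_assoc]
    gcongr
    obtain ⟨k', rfl⟩ := Nat.exists_eq_add_of_le hk
    rw [show 1 + k' - 1 = k' by omega, show 1 + k' + 1 = 2 + k' by ring, pow_add, mul_inv]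
    gcongr
    rw [← inv_pow]
    exact pow_le_pow_left₀ (by positivity) ((inv_le_inv₀ hd0 hα).mpr hd) k'

/-- **`Σ_{(n,±)} w ((s − ρ_{n,±})^{k+1})⁻¹ = Σₙ Zₙ(k,s)`** for `k ≥ 1` (absolutely convergent
rearrangement). [folklore] -/
theorem hasSum_nodeWt_mul_inv_pow (hF : Differentiable ℂ F) (hs : 1 < s.re) (hFs : F s ≠ 0)
    {k : ℕ} (hk : 1 ≤ k) :
    HasSum (fun p : ℕ × Bool ↦ (D.nodeWt p : ℂ) * ((s - D.nodeVal p) ^ (k + 1))⁻¹)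
      (∑' n, D.zeroTerm k s n) := by
  have hsum := Summable.of_norm (D.summable_norm_nodeWt_mul_inv_pow hF hs hFs hk)
  have : ∑' n, D.zeroTerm k s n =
      ∑' p : ℕ × Bool, (D.nodeWt p : ℂ) * ((s - D.nodeVal p) ^ (k + 1))⁻¹ := by
    rw [hsum.tsum_prod]
    refine tsum_congr fun n ↦ ?_
    rw [tsum_fintype, D.zeroTerm_eq_sum_bool]
  rw [this]
  exact hsum.hasSum

end SymmHadamardData

end Literature.NumberTheory.LFunctions.Stark1974

end
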